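import Literature.NumberTheory.EllipticCurves.SqrtTwoTwistPointCount
import Literature.NumberTheory.EllipticCurves.ComplexMultiplicationDeuringFrobeniusProofs
import Literature.NumberTheory.EllipticCurves.RationalIsogenyFrobeniusCriterion
import HarnessLib

/-!
# `a_p(B_n) = ±2a` with `p = a² + 2b²` at the split primes of the `j = 8000` family (Deuring, unsigned — from the tree)

Topic `Literature/NumberTheory/EllipticCurves`, namespace `Literature.NumberTheory.EllipticCurves.SqrtTwoTwist` (sequel to
`SqrtTwoTwistPointCount`).  THEOREMS ONLY.  The tree proves Deuring's `a_p = π + π̄` for the nine maximal CM `j`-invariants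
(`Deuring1941_frobeniusTrace_eq_add_conj_holds`, an `ℓ`-adic argument) in the UNSIGNED form "for SOME `π ∈ 𝓞_K` of norm `p`".  This file
reads it on the globally minimal model `256d1 = ⟨0, 4, 0, 2, 0⟩ : y² = x³ + 4x² + 2x` of `j = 8000` (`K = ℚ(√-2)`, `𝓞_K = ℤ[ω]`,
`ω = cmGen (−8) = −4 + √-2`) and on its twists `B_n`:

* `exists_sq_add_two_sq_and_frobeniusTrace_eq` — for a prime `p ≡ 1, 3 (mod 8)`: **there are `a b : ℤ` with `p = a² + 2b²` and
  `a_p(B₁) = 2a`** (on the `ℤ`-model, the tree's `Automorphic.frobeniusTrace`);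
* `exists_sq_add_two_sq_and_frobeniusTrace_B_eq` — for `p ∤ n`: `a_p(B_n) = (n/p) · 2a` with the same `(a, b)` (twist law of
  `SqrtTwoTwistPointCount`).

So `|a_p(B_n)| = 2|a|` is a THEOREM; the SIGN of `a` (Brewer 1961 / Rajwade 1968: `−(−1/p) a ≡ (−1)^{⌊p/8⌋+1} (mod 4)`) is the named
fact `Brewer1961_characterSum` of `SqrtTwoTwistBrewer`, equivalently the congruence `a_p(B₁) ≡ 2 (−1/p) (−1)^{⌊p/8⌋} (mod 8)`.
Nothing about BSD is proved here.

## References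
* M. Deuring, *Die Typen der Multiplikatorenringe elliptischer Funktionenkörper*, Abh. Math. Sem. Hamburg 14 (1941). [Deuring1941]
* D. A. Cox, *Primes of the form x² + ny²*, 2nd ed. (2013), Thm. 14.16. [Cox2013]
* A. R. Rajwade, *Arithmetic on curves with complex multiplication by √−2*, Proc. Cambridge Philos. Soc. 64 (1968), Thm. 1. [Rajwade1968]

## Mathlib / tree search
Tree: `Deuring1941_frobeniusTrace_eq_add_conj_holds` (`ComplexMultiplicationDeuringFrobeniusProofs`), `isGloballyMinimal_baseChange_int`,
`isElliptic_baseChange_int`, `forall_not_pow_dvd_or_of_bound`, `minimalDiscriminantInt_baseChange_int`, `reductionPointCount_baseChange_int`,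
`j_eq_c₄_pow_three_div_Δ`, `baseChange_int_Δ/_c₄` (`RationalIsogenyFrobeniusCriterion` and its imports), `mem_cmRing_iff`, `cmGen_add_conj`,
`cmGen_mul_conj`, `cmDiscr` (`ComplexMultiplicationCoatesWiles`), `SqrtTwoTwist.{Δ_B, c₄_B, map_int, natCard_point_eq_card_add_one_add_sum,
sum_quadraticChar_twist}`.  Mathlib: `ZMod.exists_sq_eq_neg_two_iff`.
-/

noncomputable section

open scoped Classical ComplexConjugate

namespace Literature.NumberTheory.EllipticCurves

namespace SqrtTwoTwist

open _root_.WeierstrassCurve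

/-! ### §1 The globally minimal model `256d1 = ⟨0, 4, 0, 2, 0⟩` -/

/-- `⟨0, 4, 0, 2, 0⟩ ⊗ ℚ` is a globally minimal Weierstrass equation (`Δ = 2⁹`: `2¹² ∤ Δ`, and no other prime divides `Δ`).
[cite: SilvermanAEC2009, VII.1 Remark 1.1] -/
theorem isGloballyMinimal_B_one : ((⟨0, 4, 0, 2, 0⟩ : WeierstrassCurve ℤ).baseChange ℚ).IsGloballyMinimal := by
  have hΔ : (⟨0, 4, 0, 2, 0⟩ : WeierstrassCurve ℤ).Δ = 512 := by
    simp only [WeierstrassCurve.Δ, WeierstrassCurve.b₂, WeierstrassCurve.b₄, WeierstrassCurve.b₆, WeierstrassCurve.b₈]; norm_num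
  have hc₄ : (⟨0, 4, 0, 2, 0⟩ : WeierstrassCurve ℤ).c₄ = 160 := by
    simp only [WeierstrassCurve.c₄, WeierstrassCurve.b₂, WeierstrassCurve.b₄]; norm_num
  refine isGloballyMinimal_baseChange_int _ (forall_not_pow_dvd_or_of_bound _ (B := 2) (by rw [hΔ]; decide)
    (by rw [hΔ]; decide) ?_)
  rw [hΔ, hc₄]; decide

/-- `j(⟨0, 4, 0, 2, 0⟩ ⊗ ℚ) = 8000` (`c₄³ = 160³ = 8000 · 512 = 8000 Δ`). [cite: SilvermanAdvancedTopics1994, Prop. II.2.3.1(ii)] -/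
theorem j_B_one_baseChange :
    haveI := isElliptic_baseChange_int (⟨0, 4, 0, 2, 0⟩ : WeierstrassCurve ℤ) (by
      simp only [WeierstrassCurve.Δ, WeierstrassCurve.b₂, WeierstrassCurve.b₄, WeierstrassCurve.b₆, WeierstrassCurve.b₈]; norm_num)
    ((⟨0, 4, 0, 2, 0⟩ : WeierstrassCurve ℤ).baseChange ℚ).j = 8000 := by
  have hΔ : (⟨0, 4, 0, 2, 0⟩ : WeierstrassCurve ℤ).Δ = 512 := by
    simp only [WeierstrassCurve.Δ, WeierstrassCurve.b₂, WeierstrassCurve.b₄, WeierstrassCurve.b₆, WeierstrassCurve.b₈]; norm_num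
  have hc₄ : (⟨0, 4, 0, 2, 0⟩ : WeierstrassCurve ℤ).c₄ = 160 := by
    simp only [WeierstrassCurve.c₄, WeierstrassCurve.b₂, WeierstrassCurve.b₄]; norm_num
  haveI := isElliptic_baseChange_int (⟨0, 4, 0, 2, 0⟩ : WeierstrassCurve ℤ) (by rw [hΔ]; norm_num)
  have hΔQ : ((⟨0, 4, 0, 2, 0⟩ : WeierstrassCurve ℤ).baseChange ℚ).Δ ≠ 0 := by rw [baseChange_int_Δ, hΔ]; norm_num
  rw [j_eq_c₄_pow_three_div_Δ, div_eq_iff hΔQ, baseChange_int_Δ, baseChange_int_c₄, hΔ, hc₄]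
  norm_num

/-! ### §2 Deuring, unsigned: `a_p(B₁) = 2a`, `p = a² + 2b²` -/

/-- **`a_p(B₁) = 2a` with `p = a² + 2b²` for a prime `p ≡ 1, 3 (mod 8)`** — Deuring's `a_p = π + π̄` (`π ∈ ℤ[√-2]`, `ππ̄ = p`; the
tree's `Deuring1941_frobeniusTrace_eq_add_conj_holds`, Cox Thm. 14.16) read on the globally minimal `256d1`: `π = a' + b ω`,
`ω = −4 + √-2`, `π + π̄ = 2(a' − 4b)`, `ππ̄ = (a' − 4b)² + 2b²`.  The sign of `a` is NOT determined here.
[cite: Cox2013, Thm. 14.16] [cite: Rajwade1968, Thm. 1] -/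
theorem exists_sq_add_two_sq_and_frobeniusTrace_eq {p : ℕ} (hp : p.Prime) (hp8 : p % 8 = 1 ∨ p % 8 = 3) :
    ∃ a b : ℤ, (p : ℤ) = a ^ 2 + 2 * b ^ 2 ∧
      Literature.NumberTheory.Automorphic.frobeniusTrace (⟨0, 4, 0, 2, 0⟩ : WeierstrassCurve ℤ) p = 2 * a := by
  haveI := Fact.mk hp
  set M : WeierstrassCurve ℤ := ⟨0, 4, 0, 2, 0⟩ with hM
  have hΔ : M.Δ = 512 := by
    simp only [hM, WeierstrassCurve.Δ, WeierstrassCurve.b₂, WeierstrassCurve.b₄, WeierstrassCurve.b₆, WeierstrassCurve.b₈]; norm_num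
  haveI := isElliptic_baseChange_int M (by rw [hΔ]; norm_num)
  haveI : (M.baseChange ℚ).IsGloballyMinimal := isGloballyMinimal_B_one
  have hj : (M.baseChange ℚ).j = 8000 := j_B_one_baseChange
  have hjmem : (M.baseChange ℚ).j ∈ maximalCMJInvariants := by rw [hj]; simp [maximalCMJInvariants]
  have hd : cmDiscr (M.baseChange ℚ).j = -8 := by rw [hj]; norm_num [cmDiscr]
  have hp2 : p ≠ 2 := by rintro rfl; norm_num at hp8
  have hpΔ : ¬ (p : ℤ) ∣ minimalDiscriminantInt (M.baseChange ℚ) := by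
    rw [minimalDiscriminantInt_baseChange_int, hΔ]
    intro h
    have h' : p ∣ 2 ^ 9 := by exact_mod_cast h
    exact hp2 ((Nat.prime_dvd_prime_iff_eq hp Nat.prime_two).mp (hp.dvd_of_dvd_pow h'))
  have hpd : ¬ (p : ℤ) ∣ cmDiscr (M.baseChange ℚ).j := by
    rw [hd]; intro h
    have h' : p ∣ 2 ^ 3 := by rw [dvd_neg] at h; exact_mod_cast h
    exact hp2 ((Nat.prime_dvd_prime_iff_eq hp Nat.prime_two).mp (hp.dvd_of_dvd_pow h'))
  have hsq : IsSquare ((cmDiscr (M.baseChange ℚ).j : ℤ) : ZMod p) := by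
    rw [hd]
    obtain ⟨c, hc⟩ := (ZMod.exists_sq_eq_neg_two_iff hp2).mpr hp8
    refine ⟨2 * c, ?_⟩
    push_cast
    linear_combination (4 : ZMod p) * hc
  obtain ⟨π, hπ, hππ, htr⟩ := Deuring1941_frobeniusTrace_eq_add_conj_holds (M.baseChange ℚ) hjmem p hp hp2 hpΔ hpd hsq
  rw [hd] at hπ
  obtain ⟨a', b, rfl⟩ := (mem_cmRing_iff (d := -8) (c := 18) (by norm_num) (by norm_num)).mp hπ
  -- `π + π̄ = 2a' − 8b`, `π π̄ = a'² − 8a'b + 18 b²`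
  have hω1 := cmGen_add_conj (-8)
  have hω2 := cmGen_mul_conj (d := -8) (by norm_num)
  have hconj : conj ((a' : ℂ) + b * cmGen (-8)) = a' + b * conj (cmGen (-8)) := by
    simp only [map_add, map_mul, map_intCast]
  refine ⟨a' - 4 * b, b, ?_, ?_⟩
  · have h1 : ((p : ℤ) : ℂ) = ((a' - 4 * b) ^ 2 + 2 * b ^ 2 : ℤ) := by
      push_cast
      rw [← hππ, hconj]
      have : conj (cmGen (-8)) = ((-8 : ℤ) : ℂ) - cmGen (-8) := by rw [← hω1]; ring
      rw [this]
      ring_nf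
      rw [show cmGen (-8) ^ 2 = cmGen (-8) * (((-8 : ℤ) : ℂ) - conj (cmGen (-8))) by rw [← hω1]; ring]
      rw [mul_sub, hω2]
      push_cast
      ring
    exact_mod_cast h1
  · have htr' : ((M.baseChange ℚ).frobeniusTrace p : ℂ) = ((2 * (a' - 4 * b) : ℤ) : ℂ) := by
      rw [htr, hconj]
      have : conj (cmGen (-8)) = ((-8 : ℤ) : ℂ) - cmGen (-8) := by rw [← hω1]; ring
      rw [this]; push_cast; ring
    have htr'' : (M.baseChange ℚ).frobeniusTrace p = 2 * (a' - 4 * b) := by exact_mod_cast htr'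
    rw [← htr'', WeierstrassCurve.frobeniusTrace, reductionPointCount_baseChange_int,
      Literature.NumberTheory.Automorphic.frobeniusTrace, Literature.NumberTheory.Automorphic.numPointsMod]

/-- **`a_p(B_n) = (n/p) · 2a`, `p = a² + 2b²`, for `p ≡ 1, 3 (mod 8)`, `p ∤ n`** — the unsigned Deuring theorem on the whole family (twist
law). [cite: Cox2013, Thm. 14.16] [cite: Rajwade1968, Thm. 1] -/
theorem exists_sq_add_two_sq_and_frobeniusTrace_B_eq {p : ℕ} [Fact p.Prime] (hp8 : p % 8 = 1 ∨ p % 8 = 3) {n : ℤ}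
    (hpn : ¬ (p : ℤ) ∣ n) :
    ∃ a b : ℤ, (p : ℤ) = a ^ 2 + 2 * b ^ 2 ∧
      Literature.NumberTheory.Automorphic.frobeniusTrace (⟨0, 4 * n, 0, 2 * n ^ 2, 0⟩ : WeierstrassCurve ℤ) p =
        quadraticChar (ZMod p) n * (2 * a) := by
  have hp : p.Prime := Fact.out
  obtain ⟨a, b, hab, htr⟩ := exists_sq_add_two_sq_and_frobeniusTrace_eq hp hp8
  refine ⟨a, b, hab, ?_⟩
  have hp2 : p ≠ 2 := by rintro rfl; norm_num at hp8
  have hchar : ringChar (ZMod p) ≠ 2 := by rwa [ZMod.ringChar_zmod_n]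
  have h2n : ¬ (p : ℤ) ∣ 2 * n := by
    intro h
    rcases (Nat.prime_iff_prime_int.mp hp).dvd_or_dvd h with h | h
    · exact hp2 ((Nat.prime_dvd_prime_iff_eq hp Nat.prime_two).mp (by exact_mod_cast h))
    · exact hpn h
  have h21 : ¬ (p : ℤ) ∣ 2 * 1 := by
    intro h
    exact hp2 ((Nat.prime_dvd_prime_iff_eq hp Nat.prime_two).mp (by exact_mod_cast (mul_one (2 : ℤ)) ▸ h))
  have hn0 : ((n : ℤ) : ZMod p) ≠ 0 := fun h ↦ hpn ((ZMod.intCast_zmod_eq_zero_iff_dvd n p).mp h)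
  haveI hE := isElliptic_B_zmod (p := p) h2n
  haveI hE1 := isElliptic_B_zmod (p := p) (n := 1) h21
  rw [map_int] at hE hE1
  unfold Literature.NumberTheory.Automorphic.frobeniusTrace Literature.NumberTheory.Automorphic.numPointsMod at htr ⊢
  rw [map_int, natCard_point_eq_card_add_one_add_sum hchar _ _ hE.isUnit.ne_zero, ZMod.card, sum_quadraticChar_twist 4 2 hn0]
  have h1 : (⟨0, 4, 0, 2, 0⟩ : WeierstrassCurve ℤ).map (Int.castRingHom (ZMod p)) = ⟨0, 4 * ((1 : ℤ) : ZMod p), 0, 2 * ((1 : ℤ) : ZMod p) ^ 2, 0⟩ := by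
    simp [WeierstrassCurve.map]
  rw [h1, natCard_point_eq_card_add_one_add_sum hchar _ _ hE1.isUnit.ne_zero, ZMod.card] at htr
  have hs : ∑ x : ZMod p, quadraticChar (ZMod p) (x ^ 3 + 4 * x ^ 2 + 2 * x) = -(2 * a) := by
    have : ∑ x : ZMod p, quadraticChar (ZMod p) (x ^ 3 + 4 * ((1:ℤ) : ZMod p) * x ^ 2 + 2 * ((1 : ℤ) : ZMod p) ^ 2 * x) =
        ∑ x : ZMod p, quadraticChar (ZMod p) (x ^ 3 + 4 * x ^ 2 + 2 * x) := by simp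
    rw [this] at htr
    linarith
  rw [hs]; ring

end SqrtTwoTwist

end Literature.NumberTheory.EllipticCurves

end
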